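import Mathlib.LinearAlgebra.Dimension.Constructions
import Mathlib.LinearAlgebra.Dimension.Finite
import Mathlib.LinearAlgebra.FiniteDimensional.Defs
import Mathlib.Analysis.SpecialFunctions.Pow.Asymptotics
import Literature.Computability.AlgebraicComplexity.MatrixMultiplicationExponent
import HarnessLib

/-!
# The slice (flattening) lower bounds `R(⟨k, m, n⟩) ≥ max(km, mn, kn)` and `2 ≤ ω ≤ 3`

Topic: `Literature/Computability/AlgebraicComplexity`. Fact request `wi-04434` (route
"MatrixMultiplication survey"): the flattening lower bounds `R(⟨k, m, n⟩) ≥ max(km, mn, kn)`, in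
particular `R(⟨n, n, n⟩) ≥ n²`, hence `2 ≤ ω(K) ≤ 3` for every field `K`.  Everything here is
**proved** (no named facts).

## Content

* `exists_triad_decomposition`, `exists_triad_decomposition_tensorRank` — over finite index types
  every tensor is a sum of `|ι|·|κ|·|μ|` triads, so the infimum `R(t)` is attained (Bläser 2013,
  §4).
* `rotate`, `tensorRank_rotate` — cyclic permutation of the three factors, `R(πt) = R(t)`
  (Bläser 2013, Lemma 5.3).
* `card_le_tensorRank_of_linearIndependent` — if the slices `(t a)_{a ∈ ι}` of
  `t ∈ K^{ι×κ×μ}` are linearly independent in `K^{κ×μ}`, then `|ι| ≤ R(t)` (Bläser 2013, §7,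
  proof of Lemma 7.1 (2): a tensor consisting of `N` "linearly independent slices" has rank
  `≥ N`; Bürgisser–Clausen–Shokrollahi 1997, (14.8)ff., conciseness).  Proof: a decomposition
  into `r` triads `wₗ ⊗ uₗ ⊗ vₗ` puts every slice in the span of the `r` matrices `uₗ ⊗ vₗ`.
* `linearIndependent_matMulTensor` (and `_rotate_`, `_rotate_rotate_`) — the `kn` (`km`, `mn`)
  slices of `⟨k, m, n⟩` along the first (second, third) factor are linearly independent when the
  remaining dimension is `≥ 1`; `mul_le_tensorRank_matMulTensor` (`_left`, `_right`) —
  `kn`, `km`, `mn ≤ R(⟨k, m, n⟩)`; `max_mul_le_tensorRank_matMulTensor` — all three for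
  `k, m, n ≥ 1`; `matMulTensor_sq_le_tensorRank` — `n² ≤ R(⟨n, n, n⟩)` (Bläser 2013, §5, p. 19:
  "Obviously, `r ≥ m²`" for `r = R(⟨m, m, m⟩)`; Lemma 7.1 (2): `R(⟨k, 1, n⟩) = kn` because the
  tensor "consist[s] of `kn` … linearly independent slices").
* `admissibleExponents_two_le` — every admissible exponent is `≥ 2`;
  `admissibleExponents_bddBelow`; `omega_two_le : 2 ≤ ω(K)`; `omega_le_three' : ω(K) ≤ 3`;
  `omega_mem_Icc_two_three` (Bläser 2013, §5, Def. 5.1 and p. 19; Bürgisser–Clausen–Shokrollahi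
  1997, (15.1)–(15.3)).  This discharges the hypothesis `BddBelow (admissibleExponents K)` of
  `MatrixMultiplicationExponent.omega_le_three` and the well-definedness remark of
  `Summits/MatrixMultiplication/Statement.lean` ("`ω(ℂ) ≥ 2` is the flattening bound").

Route-local proofs of `n² ≤ R(⟨n,n,n⟩)` and `2 ≤ ω` also exist in
`Summits/MatrixMultiplication/Theorems/AsymptoticSpectrum/{Flattening,OmegaGeTwo}.lean` (names
`sq_le_tensorRank_matMulTensor`, `two_le_omega`, …); the names here are deliberately different so
that both files can be imported together.

## Not vendored

Border rank `R̲(⟨n, n, n⟩) ≥ n²` (the same slice argument over `K(ε)`, Bläser 2013, proof of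
Lemma 7.1 (2)) is not stated since the tree has no border rank yet; the full statement of
Lemma 5.5 (all six permutations, which also needs the transposition `⟨k,m,n⟩ ↦ ⟨n,m,k⟩`) is not
needed for the flattenings and not proved.

## Mathlib search

Uses `LinearIndependent.fintype_card_le_finrank`, `finrank_range_le_card` (`Set.finrank`),
`Fintype.linearIndependent_iff`, `Asymptotics.isBigO_iff`, `tendsto_rpow_atTop`.  Mathlib has no
tensor rank (see `MatrixMultiplicationExponent`).

## References

* M. Bläser, *Fast Matrix Multiplication*, Theory of Computing Graduate Surveys 5 (2013), §5
  (Def. 5.1, p. 18, and p. 19), §5.1 (Lemma 5.3, Lemma 5.5), §7 (Lemma 7.1, p. 29),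
  doi:10.4086/toc.gs.2013.005. [Blaser2013]
* P. Bürgisser, M. Clausen, M. A. Shokrollahi, *Algebraic Complexity Theory*, Grundlehren 315,
  Springer 1997, (14.8), (15.1)–(15.3). [BurgisserClausenShokrollahi1997]
-/

noncomputable section

open scoped BigOperators
open Filter Asymptotics Module

namespace Literature.Computability.AlgebraicComplexity

universe u v₁ v₂ v₃

/-! ## Every tensor with finite index types is a sum of triads -/

section Decomposition

variable {K : Type u} [CommSemiring K] {ι : Type v₁} {κ : Type v₂} {μ : Type v₃}

/-- Over finite index types, `t = ∑_{a,b,c} t_{abc} e_a ⊗ e_b ⊗ e_c`; reindexed by `Fin r` with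
`r = |ι|·|κ|·|μ|`, so the set defining `tensorRank t` is non-empty (Bläser 2013, §4). [cite: Blaser2013, §4] -/
theorem exists_triad_decomposition [Fintype ι] [Fintype κ] [Fintype μ] (t : ι → κ → μ → K) :
    ∃ (r : ℕ) (w : Fin r → ι → K) (u : Fin r → κ → K) (v : Fin r → μ → K),
      t = ∑ i, triad (w i) (u i) (v i) := by
  classical
  have key : t = ∑ p : ι × κ × μ, triad (Pi.single p.1 (t p.1 p.2.1 p.2.2))
      (Pi.single p.2.1 (1 : K)) (Pi.single p.2.2 (1 : K)) := by
    funext a b c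
    rw [Finset.sum_apply, Finset.sum_apply, Finset.sum_apply]
    simp only [triad_apply]
    rw [Fintype.sum_eq_single (a, b, c)]
    · simp
    · rintro ⟨a', b', c'⟩ hne
      by_cases ha : a' = a
      · subst ha
        by_cases hb : b' = b
        · subst hb
          have hc : c' ≠ c := fun h => hne (by rw [h])
          simp [hc.symm]
        · simp [Pi.single_apply, Ne.symm hb]
      · simp [Pi.single_apply, Ne.symm ha]
  set e := Fintype.equivFin (ι × κ × μ)
  refine ⟨Fintype.card (ι × κ × μ), fun i => Pi.single (e.symm i).1 (t (e.symm i).1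
    (e.symm i).2.1 (e.symm i).2.2), fun i => Pi.single (e.symm i).2.1 1,
    fun i => Pi.single (e.symm i).2.2 1, ?_⟩
  exact key.trans (Fintype.sum_equiv e.symm
    (fun i => triad (Pi.single (e.symm i).1 (t (e.symm i).1 (e.symm i).2.1 (e.symm i).2.2))
      (Pi.single (e.symm i).2.1 (1 : K)) (Pi.single (e.symm i).2.2 (1 : K)))
    (fun p : ι × κ × μ => triad (Pi.single p.1 (t p.1 p.2.1 p.2.2)) (Pi.single p.2.1 (1 : K))
      (Pi.single p.2.2 (1 : K))) (fun _ => rfl)).symm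

/-- For finite index types the infimum defining `tensorRank` is attained: `t` is a sum of
`R(t)` triads (Bläser 2013, §4). [cite: Blaser2013, §4] -/
theorem exists_triad_decomposition_tensorRank [Fintype ι] [Fintype κ] [Fintype μ]
    (t : ι → κ → μ → K) :
    ∃ (w : Fin (tensorRank t) → ι → K) (u : Fin (tensorRank t) → κ → K)
      (v : Fin (tensorRank t) → μ → K), t = ∑ i, triad (w i) (u i) (v i) := by
  classical
  obtain ⟨r, w, u, v, h⟩ := exists_triad_decomposition t
  exact Nat.sInf_mem (s := {r : ℕ | ∃ (w : Fin r → ι → K) (u : Fin r → κ → K)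
    (v : Fin r → μ → K), t = ∑ i, triad (w i) (u i) (v i)}) ⟨r, w, u, v, h⟩

end Decomposition

/-! ## Cyclic rotation of the factors preserves the rank -/

section Rotate

variable {K : Type u} {ι : Type v₁} {κ : Type v₂} {μ : Type v₃}

/-- Cyclic rotation of the three factors of a tensor: `(rotate t)(b, c, a) = t(a, b, c)`, i.e.
`πt` for `π = (1 2 3)` (Bläser 2013, §5.1). [cite: Blaser2013, §5.1 (permutation of tensors)] -/
def rotate (t : ι → κ → μ → K) : κ → μ → ι → K := fun b c a => t a b c

/-- Entries of the rotated tensor. [cite: Blaser2013, §5.1 (permutation of tensors)] -/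
@[simp] theorem rotate_apply (t : ι → κ → μ → K) (a : ι) (b : κ) (c : μ) :
    rotate t b c a = t a b c := rfl

variable [CommSemiring K]

/-- Rotating a sum of triads rotates each triad. [cite: Blaser2013, §5.1] -/
theorem rotate_sum_triad {r : ℕ} (w : Fin r → ι → K) (u : Fin r → κ → K) (v : Fin r → μ → K) :
    rotate (∑ i, triad (w i) (u i) (v i)) = ∑ i, triad (u i) (v i) (w i) := by
  funext b c a
  simp only [rotate_apply, Finset.sum_apply, triad_apply]
  exact Finset.sum_congr rfl fun i _ => by ring

/-- **`R(πt) = R(t)`** for the cyclic permutation `π = (1 2 3)` of the factors (Bläser 2013,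
Lemma 5.3: "The proof of the following lemma is obvious"). [cite: Blaser2013, Lemma 5.3] -/
theorem tensorRank_rotate (t : ι → κ → μ → K) : tensorRank (rotate t) = tensorRank t := by
  unfold tensorRank
  congr 1
  ext r
  simp only [Set.mem_setOf_eq]
  constructor
  · rintro ⟨u, v, w, h⟩
    refine ⟨w, u, v, ?_⟩
    have ht : t = rotate (rotate (rotate t)) := rfl
    rw [ht, h, rotate_sum_triad, rotate_sum_triad]
  · rintro ⟨w, u, v, h⟩
    exact ⟨u, v, w, by rw [h, rotate_sum_triad]⟩

end Rotate

/-! ## The slice lower bound -/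

section Slices

variable {K : Type u} [Field K] {ι : Type v₁} {κ : Type v₂} {μ : Type v₃}

/-- **Slice (flattening) lower bound.** If the slices `a ↦ t(a, ·, ·) ∈ K^{κ×μ}` of a tensor
`t ∈ K^{ι×κ×μ}` are linearly independent, then `|ι| ≤ R(t)`: a decomposition
`t = ∑_{l<r} wₗ ⊗ uₗ ⊗ vₗ` gives `t(a, ·, ·) = ∑ₗ wₗ(a) · (uₗ ⊗ vₗ)`, so the `|ι|` independent
slices lie in the span of `r` matrices (Bläser 2013, §7, proof of Lemma 7.1 (2): "consist of `kn`
… linearly independent slices"; Bürgisser–Clausen–Shokrollahi 1997, (14.8)). [cite: Blaser2013, §7 (proof of Lemma 7.1 (2))] -/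
theorem card_le_tensorRank_of_linearIndependent [Fintype ι] [Fintype κ] [Fintype μ]
    (t : ι → κ → μ → K) (h : LinearIndependent K (fun a => t a : ι → κ → μ → K)) :
    Fintype.card ι ≤ tensorRank t := by
  obtain ⟨w, u, v, ht⟩ := exists_triad_decomposition_tensorRank t
  -- the `r` rank-one matrices `uₗ ⊗ vₗ`
  let M : Fin (tensorRank t) → κ → μ → K := fun l b c => u l b * v l c
  let W : Submodule K (κ → μ → K) := Submodule.span K (Set.range M)
  have hmem : ∀ a, t a ∈ W := by
    intro a
    have hta : t a = ∑ l, w l a • M l := by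
      funext b c
      refine (congr_fun (congr_fun (congr_fun ht a) b) c).trans ?_
      rw [Finset.sum_apply, Finset.sum_apply, Finset.sum_apply, Finset.sum_apply,
        Finset.sum_apply]
      refine Finset.sum_congr rfl fun l _ => ?_
      simp [M, mul_assoc]
    rw [hta]
    exact W.sum_mem fun l _ => W.smul_mem _ (Submodule.subset_span ⟨l, rfl⟩)
  -- the slices as a linearly independent family in `W`
  have h' : LinearIndependent K (fun a => (⟨t a, hmem a⟩ : W)) :=
    LinearIndependent.of_comp W.subtype h
  calc Fintype.card ι ≤ finrank K W := h'.fintype_card_le_finrank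
    _ ≤ Fintype.card (Fin (tensorRank t)) := finrank_range_le_card M
    _ = tensorRank t := Fintype.card_fin _

variable (K)

/-- The `kn` slices `⟨k, m, n⟩((κ,ν), ·, ·)` (`m ≥ 1`) are linearly independent: the slice of
`(κ, ν)` is the only one with a non-zero entry at `((κ, 0), (0, ν))` (Bläser 2013, §7, proof of
Lemma 7.1 (2)). [cite: Blaser2013, §7 (proof of Lemma 7.1 (2))] -/
theorem linearIndependent_matMulTensor (k m n : ℕ) [NeZero m] :
    LinearIndependent K (fun a => matMulTensor K k m n a :
      Fin k × Fin n → Fin k × Fin m → Fin m × Fin n → K) := by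
  rw [Fintype.linearIndependent_iff]
  intro g hg a
  obtain ⟨κ₀, ν₀⟩ := a
  have h := congr_fun (congr_fun hg (κ₀, 0)) (0, ν₀)
  rw [Finset.sum_apply, Finset.sum_apply, Fintype.sum_eq_single (κ₀, ν₀)] at h
  · simpa [matMulTensor] using h
  · rintro ⟨κ', ν'⟩ hne
    have : ¬ (κ' = κ₀ ∧ ν' = ν₀) := fun hh => hne (by rw [hh.1, hh.2])
    simp only [Pi.smul_apply, matMulTensor, true_and, smul_eq_mul, mul_ite, mul_one, mul_zero,
      ite_eq_right_iff]
    tauto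

/-- **Flattening lower bound** `kn ≤ R(⟨k, m, n⟩)` for `m ≥ 1` (Bläser 2013, §7, Lemma 7.1 (2)
and its proof; Bürgisser–Clausen–Shokrollahi 1997, (14.8): `⟨k, m, n⟩` is concise). For `m = 0`
the tensor is `0` and the bound fails. [cite: Blaser2013, Lemma 7.1 (2)] -/
theorem mul_le_tensorRank_matMulTensor (k m n : ℕ) [NeZero m] :
    k * n ≤ tensorRank (matMulTensor K k m n) := by
  simpa using card_le_tensorRank_of_linearIndependent _ (linearIndependent_matMulTensor K k m n)

/-- The `km` slices of `⟨k, m, n⟩` along the second factor (`n ≥ 1`) are linearly independent.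
[cite: Blaser2013, §7 (proof of Lemma 7.1 (2))] -/
theorem linearIndependent_rotate_matMulTensor (k m n : ℕ) [NeZero n] :
    LinearIndependent K (fun a => rotate (matMulTensor K k m n) a :
      Fin k × Fin m → Fin m × Fin n → Fin k × Fin n → K) := by
  rw [Fintype.linearIndependent_iff]
  intro g hg a
  obtain ⟨κ₀, μ₀⟩ := a
  have h := congr_fun (congr_fun hg (μ₀, 0)) (κ₀, 0)
  rw [Finset.sum_apply, Finset.sum_apply, Fintype.sum_eq_single (κ₀, μ₀)] at h
  · simpa [matMulTensor] using h
  · rintro ⟨κ', μ'⟩ hne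
    simp only [Pi.smul_apply, rotate_apply, matMulTensor, smul_eq_mul, mul_ite, mul_one,
      mul_zero, ite_eq_right_iff]
    rintro ⟨h1, h2, -⟩
    exact absurd (Prod.ext h1.symm h2) hne

/-- The `mn` slices of `⟨k, m, n⟩` along the third factor (`k ≥ 1`) are linearly independent.
[cite: Blaser2013, §7 (proof of Lemma 7.1 (2))] -/
theorem linearIndependent_rotate_rotate_matMulTensor (k m n : ℕ) [NeZero k] :
    LinearIndependent K (fun a => rotate (rotate (matMulTensor K k m n)) a :
      Fin m × Fin n → Fin k × Fin n → Fin k × Fin m → K) := by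
  rw [Fintype.linearIndependent_iff]
  intro g hg a
  obtain ⟨μ₀, ν₀⟩ := a
  have h := congr_fun (congr_fun hg (0, ν₀)) (0, μ₀)
  rw [Finset.sum_apply, Finset.sum_apply, Fintype.sum_eq_single (μ₀, ν₀)] at h
  · simpa [matMulTensor] using h
  · rintro ⟨μ', ν'⟩ hne
    simp only [Pi.smul_apply, rotate_apply, matMulTensor, smul_eq_mul, mul_ite, mul_one,
      mul_zero, ite_eq_right_iff]
    rintro ⟨-, h2, h3⟩
    exact absurd (Prod.ext h2.symm h3.symm) hne

/-- **Flattening lower bound** along the second factor: `km ≤ R(⟨k, m, n⟩)` for `n ≥ 1`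
(from `tensorRank_rotate` and the slice bound). [cite: Blaser2013, Lemma 7.1 (2) and Lemma 5.5] -/
theorem mul_le_tensorRank_matMulTensor_left (k m n : ℕ) [NeZero n] :
    k * m ≤ tensorRank (matMulTensor K k m n) := by
  rw [← tensorRank_rotate]
  simpa using
    card_le_tensorRank_of_linearIndependent _ (linearIndependent_rotate_matMulTensor K k m n)

/-- **Flattening lower bound** along the third factor: `mn ≤ R(⟨k, m, n⟩)` for `k ≥ 1`.
[cite: Blaser2013, Lemma 7.1 (2) and Lemma 5.5] -/
theorem mul_le_tensorRank_matMulTensor_right (k m n : ℕ) [NeZero k] :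
    m * n ≤ tensorRank (matMulTensor K k m n) := by
  rw [← tensorRank_rotate, ← tensorRank_rotate]
  simpa using card_le_tensorRank_of_linearIndependent _
    (linearIndependent_rotate_rotate_matMulTensor K k m n)

/-- The three flattenings together: `max(km, mn, kn) ≤ R(⟨k, m, n⟩)` for `k, m, n ≥ 1`
(Bürgisser–Clausen–Shokrollahi 1997, (14.8): `⟨k, m, n⟩` is concise; Bläser 2013, Lemma 7.1 (2)
with Lemma 5.5). [cite: Blaser2013, Lemma 7.1 (2) and Lemma 5.5] -/
theorem max_mul_le_tensorRank_matMulTensor (k m n : ℕ) [NeZero k] [NeZero m] [NeZero n] :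
    max (k * m) (max (m * n) (k * n)) ≤ tensorRank (matMulTensor K k m n) :=
  max_le (mul_le_tensorRank_matMulTensor_left K k m n)
    (max_le (mul_le_tensorRank_matMulTensor_right K k m n) (mul_le_tensorRank_matMulTensor K k m n))

/-- `n² ≤ R(⟨n, n, n⟩)` (Bläser 2013, §5, p. 19: "Obviously, `r ≥ m²`";
Bürgisser–Clausen–Shokrollahi 1997, (15.3)). [cite: Blaser2013, §5 (p. 19)] -/
theorem matMulTensor_sq_le_tensorRank (n : ℕ) : n ^ 2 ≤ tensorRank (matMulTensor K n n n) := by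
  rcases Nat.eq_zero_or_pos n with rfl | hn
  · simp
  · haveI : NeZero n := ⟨hn.ne'⟩
    simpa [sq] using mul_le_tensorRank_matMulTensor K n n n

/-! ## `2 ≤ ω ≤ 3` -/

/-- Every admissible exponent is at least `2`: if `R(⟨n,n,n⟩) = O(n^β)` then, since
`R(⟨n,n,n⟩) ≥ n²`, `n^{2-β}` is bounded, so `β ≥ 2` (Bläser 2013, §5, after Def. 5.1;
Bürgisser–Clausen–Shokrollahi 1997, (15.3)). [cite: Blaser2013, §5 (Def. 5.1, p. 19)] -/
theorem admissibleExponents_two_le {β : ℝ} (hβ : β ∈ admissibleExponents K) : 2 ≤ β := by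
  by_contra hlt
  rw [not_le] at hlt
  obtain ⟨C, hC⟩ := isBigO_iff.1 hβ
  -- eventually `n ^ (2 - β) ≤ C`
  have hev : ∀ᶠ n : ℕ in atTop, (n : ℝ) ^ (2 - β) ≤ C := by
    filter_upwards [hC, eventually_gt_atTop 0] with n hn hn0
    have hn0' : (0 : ℝ) < n := Nat.cast_pos.2 hn0
    rw [Real.norm_of_nonneg (Nat.cast_nonneg _),
      Real.norm_of_nonneg (Real.rpow_nonneg (Nat.cast_nonneg _) _)] at hn
    have hsq : (n : ℝ) ^ (2 : ℝ) ≤ C * (n : ℝ) ^ β := by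
      refine le_trans ?_ hn
      rw [Real.rpow_two]
      exact_mod_cast matMulTensor_sq_le_tensorRank K n
    rw [Real.rpow_sub hn0', div_le_iff₀ (Real.rpow_pos_of_pos hn0' _)]
    exact hsq
  -- but `n ^ (2 - β) → ∞`
  have hlim : Tendsto (fun n : ℕ => (n : ℝ) ^ (2 - β)) atTop atTop :=
    (tendsto_rpow_atTop (by linarith)).comp tendsto_natCast_atTop_atTop
  obtain ⟨n, hn₁, hn₂⟩ := (hev.and (hlim.eventually_gt_atTop C)).exists
  exact absurd hn₁ (not_le.2 hn₂)

/-- The admissible exponents are bounded below (by `2`), so `ω(K) = inf …` is a genuine infimum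
(Bläser 2013, §5). [cite: Blaser2013, §5 (Def. 5.1)] -/
theorem admissibleExponents_bddBelow : BddBelow (admissibleExponents K) :=
  ⟨2, fun _ hβ => admissibleExponents_two_le K hβ⟩

/-- **`ω(K) ≥ 2`** for every field `K` (Bläser 2013, §5; Bürgisser–Clausen–Shokrollahi 1997,
(15.3)). [cite: Blaser2013, §5 (Def. 5.1, p. 19)] -/
theorem omega_two_le : 2 ≤ omega K :=
  le_csInf (admissibleExponents_nonempty K) fun _ hβ => admissibleExponents_two_le K hβ

/-- **`ω(K) ≤ 3`** unconditionally (the hypothesis of `omega_le_three` discharged by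
`admissibleExponents_bddBelow`; Bläser 2013, §5). [cite: Blaser2013, §5] -/
theorem omega_le_three' : omega K ≤ 3 :=
  omega_le_three K (admissibleExponents_bddBelow K)

/-- `2 ≤ ω(K) ≤ 3` (Bläser 2013, §5). [cite: Blaser2013, §5] -/
theorem omega_mem_Icc_two_three : omega K ∈ Set.Icc (2 : ℝ) 3 :=
  ⟨omega_two_le K, omega_le_three' K⟩

end Slices

end Literature.Computability.AlgebraicComplexity

end
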